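import Summits.ValiantsHypothesis.ValiantsHypothesis.Theorems.LacunarySymmetroidMatrixDescartesFiniteSectorPairSumMasks

/-!
# `MatrixDescartes` — line «finite»: `σ(60,4) = 26438` finite core, kernel slices, TWO-LEVEL (part UC)

HONEST FRAMING.  Object-search cell `pub-symmetroid`, seat val-sym-door-p5 g12.  HELPER of the crux item `stmt-ValiantsHypothesis-18050` with NO closure claim and no statement about
pencils: TWO-LEVEL SLICES (value #2 of the sorted free values in a range AND value #3 in a range) of the pruned enumeration behind `HypRootLawAt 60 4 26438`
(transfer in `…FiniteSectorSectorCeilingSixtyFour`), in the WALKER shape of `…FiniteSectorIterMasksWalk` (seat val-sym-door-p5 g11): every slice is one Bool term (raw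
`Nat.rec` walkers over the candidates of each level, children of a prefix = an interval by the monotone alive guard — at the two SLICED levels the EXACT alive test below the cap (seat g12: a slice starting above the natural start admits no dead prefix), `60`-fold sums as lagged raw-recursor
iterates of the shift-or step, the last level incremental over the cached prefix masks), `decide +kernel`.  The whole enumeration has 198 313 live
prefixes.  Nothing here bears on the crux, the doors, or `VP ≠ VNP`.
[folklore] Gap-rule / sieve bookkeeping plus a finite enumeration; no citation is load-bearing.
-/

-- `Summit.ValiantsHypothesis.ValiantsHypothesis.…` repeats a component by the D-0017 layout
-- (single-conjunct summit), which the `dupNamespace` linter flags; the name is mandated.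
set_option linter.dupNamespace false

namespace Summit.ValiantsHypothesis.ValiantsHypothesis.Theorems.LacunarySymmetroidMatrixDescartes.FiniteSector

set_option synthInstance.maxSize 2000000 in
set_option synthInstance.maxHeartbeats 2000000 in
set_option maxHeartbeats 4000000 in
set_option maxRecDepth 100000 in
/-- **Finite core of `σ(60,4) = 26438`, slice: value #2 in `[93, 26442)`, value #3 in `[1020, 1411)`** (3 531 live prefixes;
the pruned nested enumeration of the sorted value lists as ONE Bool walker term — raw `Nat.rec` levels, lagged raw-recursor `60`-fold sum masks,
incremental last level; `decide` in the kernel). [folklore] -/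
theorem sectorWalk_sixty_four_s2_93_26442_s3_1020_1411 :
    (@Nat.rec (fun _ => ℕ → Bool) (fun _ => true) (fun (_ : ℕ) (ih : ℕ → Bool) (a : ℕ) => cond ((Nat.ble (26438 + 2) a || Nat.beq (Nat.mod (Nat.div (Nat.lor (@Nat.rec (fun _ => ℕ) ((fun (E : ℕ) => @List.rec ℕ (fun _ => ℕ) 0 (fun (x : ℕ) (_ : List ℕ) (acc : ℕ) => Nat.lor acc (Nat.shiftLeft E x)) [0]) 1) (fun (_ acc : ℕ) => (fun (E : ℕ) => @List.rec ℕ (fun _ => ℕ) 0 (fun (x : ℕ) (_ : List ℕ) (acc : ℕ) => Nat.lor acc (Nat.shiftLeft E x)) [0]) acc) 59) (Nat.div (@Nat.rec (fun _ => ℕ) ((fun (E : ℕ) => @List.rec ℕ (fun _ => ℕ) 0 (fun (x : ℕ) (_ : List ℕ) (acc : ℕ) => Nat.lor acc (Nat.shiftLeft E x)) [0]) 1) (fun (_ acc : ℕ) => (fun (E : ℕ) => @List.rec ℕ (fun _ => ℕ) 0 (fun (x : ℕ) (_ : List ℕ) (acc : ℕ) => Nat.lor acc (Nat.shiftLeft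 E x)) [0]) acc) 59) 2)) (Nat.pow 2 (a - 2))) 2) 1)) (((@Nat.rec (fun _ => ℕ → Bool) (fun _ => true) (fun (_ : ℕ) (ih : ℕ → Bool) (b : ℕ) => cond (Nat.beq (Nat.mod (Nat.lor (@Nat.rec (fun _ => ℕ) ((fun (E : ℕ) => @List.rec ℕ (fun _ => ℕ) 0 (fun (x : ℕ) (_ : List ℕ) (acc : ℕ) => Nat.lor acc (Nat.shiftLeft E x)) [0, a]) 1) (fun (_ acc : ℕ) => (fun (E : ℕ) => @List.rec ℕ (fun _ => ℕ) 0 (fun (x : ℕ) (_ : List ℕ) (acc : ℕ) => Nat.lor acc (Nat.shiftLeft E x)) [0, a]) acc) 59) (Nat.div (@Nat.rec (fun _ => ℕ) ((fun (E : ℕ) => @List.rec ℕ (fun _ => ℕ) 0 (fun (x : ℕ) (_ : List ℕ) (acc : ℕ) => Nat.lor acc (Nat.shiftLeft E x)) [0, a]) 1) (fun (_ acc : ℕ) => (fun (E : ℕ) => @List.rec ℕ (fun _ => ℕ) 0 (fun (x : ℕ) (_ : List ℕ) (acc : ℕ) => Nat.lor acc (Nat.shiftLeft E x)) [0, a]) acc)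 59) 2)) (2 ^ ((b - 1) - ((b - 1) - 26438)))) (2 ^ ((b - 1) - ((b - 1) - 26438)) - 1)) (((@Nat.rec (fun _ => ℕ → Bool) (fun _ => true) (fun (_ : ℕ) (ih : ℕ → Bool) (c : ℕ) => cond (Nat.beq (Nat.mod (Nat.lor (@Nat.rec (fun _ => ℕ) ((fun (E : ℕ) => @List.rec ℕ (fun _ => ℕ) 0 (fun (x : ℕ) (_ : List ℕ) (acc : ℕ) => Nat.lor acc (Nat.shiftLeft E x)) [0, a, b]) 1) (fun (_ acc : ℕ) => (fun (E : ℕ) => @List.rec ℕ (fun _ => ℕ) 0 (fun (x : ℕ) (_ : List ℕ) (acc : ℕ) => Nat.lor acc (Nat.shiftLeft E x)) [0, a, b]) acc) 59) (Nat.div (@Nat.rec (fun _ => ℕ) ((fun (E : ℕ) => @List.rec ℕ (fun _ => ℕ) 0 (fun (x : ℕ) (_ : List ℕ) (acc : ℕ) => Nat.lor acc (Nat.shiftLeft E x)) [0, a, b]) 1) (fun (_ acc : ℕ) => (fun (E : ℕ) => @List.rec ℕ (fun _ => ℕ) 0 (fun (x : ℕ) (_ : List ℕ) (acc : ℕ)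 => Nat.lor acc (Nat.shiftLeft E x)) [0, a, b]) acc) 59) 2)) (2 ^ ((c - 1) - ((c - 1) - 26438)))) (2 ^ ((c - 1) - ((c - 1) - 26438)) - 1)) (((!(Nat.beq (Nat.mod (Nat.lor (@Nat.rec (fun _ => ℕ) 1 (fun (k acc : ℕ) => Nat.lor (@Nat.rec (fun _ => ℕ) ((fun (E : ℕ) => @List.rec ℕ (fun _ => ℕ) 0 (fun (x : ℕ) (_ : List ℕ) (acc : ℕ) => Nat.lor acc (Nat.shiftLeft E x)) [0, a, b]) 1) (fun (_ acc : ℕ) => (fun (E : ℕ) => @List.rec ℕ (fun _ => ℕ) 0 (fun (x : ℕ) (_ : List ℕ) (acc : ℕ) => Nat.lor acc (Nat.shiftLeft E x)) [0, a, b]) acc) k) (Nat.shiftLeft acc c)) 60) (Nat.div (@Nat.rec (fun _ => ℕ) 1 (fun (k acc : ℕ) => Nat.lor (@Nat.rec (fun _ => ℕ) ((fun (E : ℕ) => @List.rec ℕ (fun _ => ℕ) 0 (fun (x : ℕ) (_ : List ℕ) (acc : ℕ) => Nat.lor acc (Nat.shiftLeft E x)) [0, a, b]) 1) (fun (_ acc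 : ℕ) => (fun (E : ℕ) => @List.rec ℕ (fun _ => ℕ) 0 (fun (x : ℕ) (_ : List ℕ) (acc : ℕ) => Nat.lor acc (Nat.shiftLeft E x)) [0, a, b]) acc) k) (Nat.shiftLeft acc c)) 60) 2)) (2 ^ 26438)) (2 ^ 26438 - 1)) || (!(Nat.beq (Nat.mod (Nat.div (@Nat.rec (fun _ => ℕ) 1 (fun (k acc : ℕ) => Nat.lor (@Nat.rec (fun _ => ℕ) ((fun (E : ℕ) => @List.rec ℕ (fun _ => ℕ) 0 (fun (x : ℕ) (_ : List ℕ) (acc : ℕ) => Nat.lor acc (Nat.shiftLeft E x)) [0, a, b]) 1) (fun (_ acc : ℕ) => (fun (E : ℕ) => @List.rec ℕ (fun _ => ℕ) 0 (fun (x : ℕ) (_ : List ℕ) (acc : ℕ) => Nat.lor acc (Nat.shiftLeft E x)) [0, a, b]) acc) k) (Nat.shiftLeft acc c)) 60) (2 ^ 26439)) 2) 1) && (!(Nat.beq (Nat.mod (Nat.div (@Nat.rec (fun _ => ℕ) 1 (fun (k acc : ℕ) => Nat.lor (@Nat.rec (fun _ => ℕ) ((fun (E : ℕ) => @List.rec ℕ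 (fun _ => ℕ) 0 (fun (x : ℕ) (_ : List ℕ) (acc : ℕ) => Nat.lor acc (Nat.shiftLeft E x)) [0, a, b]) 1) (fun (_ acc : ℕ) => (fun (E : ℕ) => @List.rec ℕ (fun _ => ℕ) 0 (fun (x : ℕ) (_ : List ℕ) (acc : ℕ) => Nat.lor acc (Nat.shiftLeft E x)) [0, a, b]) acc) k) (Nat.shiftLeft acc c)) 60) (2 ^ 26438)) 2) 1) || !(Nat.beq (Nat.mod (Nat.div (@Nat.rec (fun _ => ℕ) 1 (fun (k acc : ℕ) => Nat.lor (@Nat.rec (fun _ => ℕ) ((fun (E : ℕ) => @List.rec ℕ (fun _ => ℕ) 0 (fun (x : ℕ) (_ : List ℕ) (acc : ℕ) => Nat.lor acc (Nat.shiftLeft E x)) [0, a, b]) 1) (fun (_ acc : ℕ) => (fun (E : ℕ) => @List.rec ℕ (fun _ => ℕ) 0 (fun (x : ℕ) (_ : List ℕ) (acc : ℕ) => Nat.lor acc (Nat.shiftLeft E x)) [0, a, b]) acc) k) (Nat.shiftLeft acc c)) 60) (2 ^ 26440)) 2) 1))))) && ih (c + 1)) true) ((1411 - ((b + 1) + (1020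 - (b + 1))))) (((b + 1) + (1020 - (b + 1)))))) && ih (b + 1)) true) ((26442 - ((a + 1) + (93 - (a + 1))))) (((a + 1) + (93 - (a + 1)))))) && ih (a + 1)) true) (26442 - (1)) (1)) = true := by
  decide +kernel

set_option synthInstance.maxSize 2000000 in
set_option synthInstance.maxHeartbeats 2000000 in
set_option maxHeartbeats 4000000 in
set_option maxRecDepth 100000 in
/-- **Finite core of `σ(60,4) = 26438`, slice: value #2 in `[93, 26442)`, value #3 in `[1411, 26442)`** (243 live prefixes;
the pruned nested enumeration of the sorted value lists as ONE Bool walker term — raw `Nat.rec` levels, lagged raw-recursor `60`-fold sum masks,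
incremental last level; `decide` in the kernel). [folklore] -/
theorem sectorWalk_sixty_four_s2_93_26442_s3_1411_26442 :
    (@Nat.rec (fun _ => ℕ → Bool) (fun _ => true) (fun (_ : ℕ) (ih : ℕ → Bool) (a : ℕ) => cond ((Nat.ble (26438 + 2) a || Nat.beq (Nat.mod (Nat.div (Nat.lor (@Nat.rec (fun _ => ℕ) ((fun (E : ℕ) => @List.rec ℕ (fun _ => ℕ) 0 (fun (x : ℕ) (_ : List ℕ) (acc : ℕ) => Nat.lor acc (Nat.shiftLeft E x)) [0]) 1) (fun (_ acc : ℕ) => (fun (E : ℕ) => @List.rec ℕ (fun _ => ℕ) 0 (fun (x : ℕ) (_ : List ℕ) (acc : ℕ) => Nat.lor acc (Nat.shiftLeft E x)) [0]) acc) 59) (Nat.div (@Nat.rec (fun _ => ℕ) ((fun (E : ℕ) => @List.rec ℕ (fun _ => ℕ) 0 (fun (x : ℕ) (_ : List ℕ) (acc : ℕ) => Nat.lor acc (Nat.shiftLeft E x)) [0]) 1) (fun (_ acc : ℕ) => (fun (E : ℕ) => @List.rec ℕ (fun _ => ℕ) 0 (fun (x : ℕ) (_ : List ℕ) (acc : ℕ)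 => Nat.lor acc (Nat.shiftLeft E x)) [0]) acc) 59) 2)) (Nat.pow 2 (a - 2))) 2) 1)) (((@Nat.rec (fun _ => ℕ → Bool) (fun _ => true) (fun (_ : ℕ) (ih : ℕ → Bool) (b : ℕ) => cond (Nat.beq (Nat.mod (Nat.lor (@Nat.rec (fun _ => ℕ) ((fun (E : ℕ) => @List.rec ℕ (fun _ => ℕ) 0 (fun (x : ℕ) (_ : List ℕ) (acc : ℕ) => Nat.lor acc (Nat.shiftLeft E x)) [0, a]) 1) (fun (_ acc : ℕ) => (fun (E : ℕ) => @List.rec ℕ (fun _ => ℕ) 0 (fun (x : ℕ) (_ : List ℕ) (acc : ℕ) => Nat.lor acc (Nat.shiftLeft E x)) [0, a]) acc) 59) (Nat.div (@Nat.rec (fun _ => ℕ) ((fun (E : ℕ) => @List.rec ℕ (fun _ => ℕ) 0 (fun (x : ℕ) (_ : List ℕ) (acc : ℕ) => Nat.lor acc (Nat.shiftLeft E x)) [0, a]) 1) (fun (_ acc : ℕ) => (fun (E : ℕ) => @List.rec ℕ (fun _ => ℕ) 0 (fun (x : ℕ) (_ : List ℕ) (acc : ℕ) => Nat.lor acc (Nat.shiftLeft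 E x)) [0, a]) acc) 59) 2)) (2 ^ ((b - 1) - ((b - 1) - 26438)))) (2 ^ ((b - 1) - ((b - 1) - 26438)) - 1)) (((@Nat.rec (fun _ => ℕ → Bool) (fun _ => true) (fun (_ : ℕ) (ih : ℕ → Bool) (c : ℕ) => cond (Nat.beq (Nat.mod (Nat.lor (@Nat.rec (fun _ => ℕ) ((fun (E : ℕ) => @List.rec ℕ (fun _ => ℕ) 0 (fun (x : ℕ) (_ : List ℕ) (acc : ℕ) => Nat.lor acc (Nat.shiftLeft E x)) [0, a, b]) 1) (fun (_ acc : ℕ) => (fun (E : ℕ) => @List.rec ℕ (fun _ => ℕ) 0 (fun (x : ℕ) (_ : List ℕ) (acc : ℕ) => Nat.lor acc (Nat.shiftLeft E x)) [0, a, b]) acc) 59) (Nat.div (@Nat.rec (fun _ => ℕ) ((fun (E : ℕ) => @List.rec ℕ (fun _ => ℕ) 0 (fun (x : ℕ) (_ : List ℕ) (acc : ℕ) => Nat.lor acc (Nat.shiftLeft E x)) [0, a, b]) 1) (fun (_ acc : ℕ) => (fun (E : ℕ) => @List.rec ℕ (fun _ => ℕ) 0 (fun (x : ℕ) (_ : List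 ℕ) (acc : ℕ) => Nat.lor acc (Nat.shiftLeft E x)) [0, a, b]) acc) 59) 2)) (2 ^ ((c - 1) - ((c - 1) - 26438)))) (2 ^ ((c - 1) - ((c - 1) - 26438)) - 1)) (((!(Nat.beq (Nat.mod (Nat.lor (@Nat.rec (fun _ => ℕ) 1 (fun (k acc : ℕ) => Nat.lor (@Nat.rec (fun _ => ℕ) ((fun (E : ℕ) => @List.rec ℕ (fun _ => ℕ) 0 (fun (x : ℕ) (_ : List ℕ) (acc : ℕ) => Nat.lor acc (Nat.shiftLeft E x)) [0, a, b]) 1) (fun (_ acc : ℕ) => (fun (E : ℕ) => @List.rec ℕ (fun _ => ℕ) 0 (fun (x : ℕ) (_ : List ℕ) (acc : ℕ) => Nat.lor acc (Nat.shiftLeft E x)) [0, a, b]) acc) k) (Nat.shiftLeft acc c)) 60) (Nat.div (@Nat.rec (fun _ => ℕ) 1 (fun (k acc : ℕ) => Nat.lor (@Nat.rec (fun _ => ℕ) ((fun (E : ℕ) => @List.rec ℕ (fun _ => ℕ) 0 (fun (x : ℕ) (_ : List ℕ) (acc : ℕ) => Nat.lor acc (Nat.shiftLeft E x)) [0, a,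 b]) 1) (fun (_ acc : ℕ) => (fun (E : ℕ) => @List.rec ℕ (fun _ => ℕ) 0 (fun (x : ℕ) (_ : List ℕ) (acc : ℕ) => Nat.lor acc (Nat.shiftLeft E x)) [0, a, b]) acc) k) (Nat.shiftLeft acc c)) 60) 2)) (2 ^ 26438)) (2 ^ 26438 - 1)) || (!(Nat.beq (Nat.mod (Nat.div (@Nat.rec (fun _ => ℕ) 1 (fun (k acc : ℕ) => Nat.lor (@Nat.rec (fun _ => ℕ) ((fun (E : ℕ) => @List.rec ℕ (fun _ => ℕ) 0 (fun (x : ℕ) (_ : List ℕ) (acc : ℕ) => Nat.lor acc (Nat.shiftLeft E x)) [0, a, b]) 1) (fun (_ acc : ℕ) => (fun (E : ℕ) => @List.rec ℕ (fun _ => ℕ) 0 (fun (x : ℕ) (_ : List ℕ) (acc : ℕ) => Nat.lor acc (Nat.shiftLeft E x)) [0, a, b]) acc) k) (Nat.shiftLeft acc c)) 60) (2 ^ 26439)) 2) 1) && (!(Nat.beq (Nat.mod (Nat.div (@Nat.rec (fun _ => ℕ) 1 (fun (k acc : ℕ) => Nat.lor (@Nat.rec (fun _ => ℕ) ((fun (E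 : ℕ) => @List.rec ℕ (fun _ => ℕ) 0 (fun (x : ℕ) (_ : List ℕ) (acc : ℕ) => Nat.lor acc (Nat.shiftLeft E x)) [0, a, b]) 1) (fun (_ acc : ℕ) => (fun (E : ℕ) => @List.rec ℕ (fun _ => ℕ) 0 (fun (x : ℕ) (_ : List ℕ) (acc : ℕ) => Nat.lor acc (Nat.shiftLeft E x)) [0, a, b]) acc) k) (Nat.shiftLeft acc c)) 60) (2 ^ 26438)) 2) 1) || !(Nat.beq (Nat.mod (Nat.div (@Nat.rec (fun _ => ℕ) 1 (fun (k acc : ℕ) => Nat.lor (@Nat.rec (fun _ => ℕ) ((fun (E : ℕ) => @List.rec ℕ (fun _ => ℕ) 0 (fun (x : ℕ) (_ : List ℕ) (acc : ℕ) => Nat.lor acc (Nat.shiftLeft E x)) [0, a, b]) 1) (fun (_ acc : ℕ) => (fun (E : ℕ) => @List.rec ℕ (fun _ => ℕ) 0 (fun (x : ℕ) (_ : List ℕ) (acc : ℕ) => Nat.lor acc (Nat.shiftLeft E x)) [0, a, b]) acc) k) (Nat.shiftLeft acc c)) 60) (2 ^ 26440)) 2) 1))))) && ih (c + 1)) true)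 ((26442 - ((b + 1) + (1411 - (b + 1))))) (((b + 1) + (1411 - (b + 1)))))) && ih (b + 1)) true) ((26442 - ((a + 1) + (93 - (a + 1))))) (((a + 1) + (93 - (a + 1)))))) && ih (a + 1)) true) (26442 - (1)) (1)) = true := by
  decide +kernel

end Summit.ValiantsHypothesis.ValiantsHypothesis.Theorems.LacunarySymmetroidMatrixDescartes.FiniteSector
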